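/-
Copyright (c) 2026 the pub-hodgecm-mathlib formalisation cell (harness21).  Prover seat hodgecm-mathlib-K2E4-p14 (g5), Track B ∕ K2-LIT, h413 =
`stmt-HodgeConjecture-24833`, line `K2_E1_TraceFormulaBeta`, campaign «EIS-RANK-ONE» rung R6f(iii); DEAL «EIS-R6f-iii» of the dealer K2E1-plan (g3)
2026-09-04T04:44:28Z, heads «=» 04:48:06Z.  PART 1∕2 of `K2E1TorusHeightMellin` (the ≤ 400-line law): Tate at a general threshold, the weighted norm profile, orthogonality.
-/
import Literature.NumberTheory.Automorphic.IdeleClassIntegration      -- ★ `logNorm`, `normProfile`, `idelicCovolume`, Tate's formulas at `T₀ = 1`, `setIntegral_comp_logNorm_eq`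
import Mathlib.Analysis.SpecialFunctions.ImproperIntegrals             -- Mathlib `integral_exp_mul_complex_Iic ∕ _Ioi`
import HarnessLib

/-!
# K2·E1 — `K2E1IdeleClassMellinWeighted`: TATE'S FORMULAS AT A THRESHOLD `T₀`, THE `ψ`-WEIGHTED NORM PROFILE OF THE IDELE CLASS GROUP, ORTHOGONALITY
# (campaign «EIS-RANK-ONE», rung R6f(iii), part 1∕2 — the idele-class engine under `K2E1TorusHeightMellin`)

Track B ∕ K2-LIT, crux h413 = `stmt-HodgeConjecture-24833`, route of record `HCCMUnconditional`; cell `hodgecm-mathlib`, squad K2, ENGINE E1.  Prover seat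
`hodgecm-mathlib-K2E4-p14` (g5); DEAL «EIS-R6f-iii» of the dealer K2E1-plan (g3) (SPEC `SPEC-EIS-R6-MaassSelberg` §2 R6f(iii)), heads «=» 2026-09-04T04:48:06Z («idele level,
`K`-generic»).  THEOREMS ONLY (no `def`, no `instance`, no notation, no named-fact hypothesis, no `sorry`); lane `--supports stmt-HodgeConjecture-24833 --as helper`
(count-neutral).  Closes no socket.  Part 2∕2 (`K2E1TorusHeightMellin`: the Bochner heads `∫ ‖x‖^s Ψ = (T₀^s∕s)·[Ψ]`, `[1] = V`, `[η] = 0`, the torus reading) imports this file.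

THE MATHEMATICS.  `K` a number field, `𝕀_K` its idele group, `ν` a left-invariant Borel measure on `𝕀_K` finite on compacta (and positive on opens where integrability is read), `𝓕 ⊆ 𝕀_K`
a fundamental domain for `K^×` (★ `IsIdeleClassDomain`), `V = idelicCovolume K ν` (★; Tate's `κ`), `M = z(ℝ_{>0})` the split component (★ `posRealIdele`), `Re s > 0`, `T₀ > 0`.
* §1 **`∫_{𝓕 ∩ {‖x‖ ≤ T₀}} ‖x‖^s dν = V · T₀^s ∕ s`**, **`∫_{𝓕 ∩ {T₀ < ‖x‖}} ‖x‖^{-s} dν = V · T₀^{-s} ∕ s`**, absolutely convergent — Tate's "`∫₀^1 κ t^s dt∕t = κ∕s`" (proof of the Main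
  Theorem 4.4.1, Lemma B) at a general threshold (★ `setIntegral_comp_logNorm_eq` with `B = Iic ∕ Ioi (log T₀)`). [CasselsFrohlichANT1967, Ch. XV §4.4]
* §2 THE WEIGHTED NORM PROFILE: for a density `ψ : 𝕀_K → [0,∞]` bounded, `K^×`-invariant AND `M`-invariant (`ψ(z(r)·x) = ψ(x)`), the image of `(ψν)|_𝓕` under `log ‖·‖` is
  **`c_ψ · du`, `c_ψ = (ψν)({0 ≤ log ‖x‖ < 1} ∩ 𝓕)`** — translation invariance (translate by `z(r)`: `ν` left-invariant, `ψ` `M`-invariant, independence of the fundamental domain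
  for the `K^×`-invariant measure `ψν`), finiteness on compacta, uniqueness of Haar measure on `ℝ`: the weighted twin of ★ `normProfile_eq_smul_volume`, i.e. Tate's `d𝔞 = d𝔟·dt∕t`
  on `I = J × ℝ_{>0}` [CasselsFrohlichANT1967, Ch. XV Thm. 4.3.2; WeilBNT1967, Ch. VII §5] with the weight riding on the compact factor `J∕k^×`.  Consequence `∫⁻ f(log ‖x‖) ψ = c_ψ ∫⁻_B f`.
* §3 `ν({0 ≤ log ‖x‖ < 1} ∩ 𝓕) = V` and ORTHOGONALITY: **`∫_{𝓕 ∩ {0 ≤ log ‖x‖ < 1}} η dν = 0`** for a multiplicative `η : 𝕀_K →* ℂ` trivial on `K^×` and `M` with `η ≢ 1` (translate by a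
  norm-one `b` with `η(b) ≠ 1`: a non-trivial character of the compact group `𝕀_K¹∕K^×` has mean zero) [WeilBNT1967, Ch. VII §5].
HONEST LABEL: HC_CM is proved only modulo the 7 printed citations (2 remaining named inputs: hLiu418 = `stmt-HodgeConjecture-24832`, h413 = `stmt-HodgeConjecture-24833`) until rung 0
closes; this file asserts no named fact and closes no socket.
References: [CasselsFrohlichANT1967] J. Tate, *Fourier analysis in number fields and Hecke's zeta-functions*, in Cassels–Fröhlich (eds.), *Algebraic Number Theory* (1967), Ch. XV §4.3–4.4 ·
[WeilBNT1967] A. Weil, *Basic Number Theory* (1967), Ch. IV §4, Ch. VII §5 · [MoeglinWaldspurger1995] C. Mœglin, J.-L. Waldspurger, *Spectral Decomposition and Eisenstein Series*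
(1995), IV.2.1.
-/

set_option autoImplicit false
-- the mandated namespace repeats the single-problem summit's segment (`HodgeConjecture.HodgeConjecture`)
set_option linter.dupNamespace false

noncomputable section

open MeasureTheory Measure NumberField IsDedekindDomain Set Filter
open scoped ENNReal NNReal Pointwise Topology
open Literature.NumberTheory Literature.NumberTheory.Automorphic

namespace Summit.HodgeConjecture.HodgeConjecture.Cruxes.H413.K2E1IdeleClassMellinWeighted

variable {K : Type} [Field K] [NumberField K]

/-! ## §0 Thresholds: `{‖x‖ ≤ T₀}`, `{T₀ < ‖x‖}` as log-norm shells; `T₀ ^ s` as an exponential -/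

/-- `{‖x‖ ≤ T₀} = {log ‖x‖ ≤ log T₀}` (`T₀ > 0`). [folklore] -/
theorem setOf_ideleNorm_le_eq {T₀ : ℝ} (hT : 0 < T₀) :
    {x : GaloisRepresentations.ideleGroup K | (IdeleClassGroup.ideleNorm K x : ℝ) ≤ T₀} = logNorm K ⁻¹' Iic (Real.log T₀) := by
  ext x
  simp only [mem_setOf_eq, mem_preimage, mem_Iic, logNorm]
  exact (Real.log_le_log_iff (ideleNorm_real_pos x) hT).symm

/-- `{T₀ < ‖x‖} = {log T₀ < log ‖x‖}` (`T₀ > 0`). [folklore] -/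
theorem setOf_lt_ideleNorm_eq {T₀ : ℝ} (hT : 0 < T₀) :
    {x : GaloisRepresentations.ideleGroup K | T₀ < (IdeleClassGroup.ideleNorm K x : ℝ)} = logNorm K ⁻¹' Ioi (Real.log T₀) := by
  ext x
  simp only [mem_setOf_eq, mem_preimage, mem_Ioi, logNorm]
  exact (Real.log_lt_log_iff hT (ideleNorm_real_pos x)).symm

/-- `{‖x‖ ≤ 1} = {log ‖x‖ ≤ 0}` in the form used below. [folklore] -/
theorem setOf_ideleNorm_le_one_eq' :
    {x : GaloisRepresentations.ideleGroup K | (IdeleClassGroup.ideleNorm K x : ℝ) ≤ 1} = logNorm K ⁻¹' Iic (Real.log 1) := by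
  rw [Real.log_one]; exact setOf_ideleNorm_le_one_eq

/-- `T₀ ^ s = exp (s · log T₀)` for `T₀ > 0` (principal branch). [folklore] -/
theorem ofReal_cpow_eq_exp {T₀ : ℝ} (hT : 0 < T₀) (s : ℂ) :
    ((T₀ : ℝ) : ℂ) ^ s = Complex.exp (s * (Real.log T₀ : ℝ)) := by
  rw [Complex.cpow_def_of_ne_zero (Complex.ofReal_ne_zero.mpr hT.ne'), ← Complex.ofReal_log hT.le, mul_comm]

/-! ## §1 Tate's formulas at a general threshold `T₀` -/

section Tate

variable [MeasurableSpace (GaloisRepresentations.ideleGroup K)] [BorelSpace (GaloisRepresentations.ideleGroup K)]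

/-- **`∫_{𝓕 ∩ {‖x‖ ≤ T₀}} ‖x‖^s dν = V · T₀^s ∕ s`** (`Re s > 0`, `T₀ > 0`), the integral converging absolutely: Tate's "`∫₀^1 κ t^s dt∕t = κ∕s`" (proof of the Main Theorem 4.4.1,
Lemma B) at the threshold `T₀` — along `u = log ‖x‖` the restriction `ν|_𝓕` is `V du` (★ `setIntegral_comp_logNorm_eq`) and `∫_{u ≤ log T₀} e^{su} du = T₀^s∕s`.
[cite: CasselsFrohlichANT1967, Ch. XV Thm. 4.4.1 (proof, Lemma B)] [cite: MoeglinWaldspurger1995, IV.2.1] -/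
theorem integrableOn_and_setIntegral_ideleNorm_cpow_of_le (ν : Measure (GaloisRepresentations.ideleGroup K))
    [ν.IsMulLeftInvariant] [IsFiniteMeasureOnCompacts ν] [ν.IsOpenPosMeasure]
    {𝓕 : Set (GaloisRepresentations.ideleGroup K)}
    (h𝓕 : IsFundamentalDomain (GaloisRepresentations.principalIdeles K) 𝓕 ν) {s : ℂ} (hs : 0 < s.re) {T₀ : ℝ} (hT : 0 < T₀) :
    IntegrableOn (fun x => ((IdeleClassGroup.ideleNorm K x : ℝ) : ℂ) ^ s)
        ({x | (IdeleClassGroup.ideleNorm K x : ℝ) ≤ T₀} ∩ 𝓕) ν ∧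
      ∫ x in {x | (IdeleClassGroup.ideleNorm K x : ℝ) ≤ T₀} ∩ 𝓕,
          ((IdeleClassGroup.ideleNorm K x : ℝ) : ℂ) ^ s ∂ν = (idelicCovolume K ν).toReal * (((T₀ : ℝ) : ℂ) ^ s / s) := by
  have hfun : (fun x : GaloisRepresentations.ideleGroup K => ((IdeleClassGroup.ideleNorm K x : ℝ) : ℂ) ^ s) =
      fun x => (fun u : ℝ => Complex.exp (s * u)) (logNorm K x) := by
    funext x; exact ideleNorm_cpow_eq_exp x s
  have hcont : Continuous fun u : ℝ => Complex.exp (s * u) :=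
    Complex.continuous_exp.comp (continuous_const.mul Complex.continuous_ofReal)
  rw [setOf_ideleNorm_le_eq hT, hfun]
  refine ⟨?_, ?_⟩
  · rw [integrableOn_comp_logNorm_iff ν h𝓕 measurableSet_Iic hcont.aestronglyMeasurable]
    exact integrableOn_exp_mul_complex_Iic hs _
  · rw [setIntegral_comp_logNorm_eq ν h𝓕 measurableSet_Iic hcont.aestronglyMeasurable, integral_exp_mul_complex_Iic hs,
      Complex.real_smul, ofReal_cpow_eq_exp hT]

/-- **`∫_{𝓕 ∩ {T₀ < ‖x‖}} ‖x‖^{-s} dν = V · T₀^{-s} ∕ s`** (`Re s > 0`, `T₀ > 0`), absolutely convergent — the mirror (`𝔟 ↦ 1∕𝔟`) of the previous formula: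
`∫_{log T₀ < u} e^{-su} du = T₀^{-s}∕s`. [cite: CasselsFrohlichANT1967, Ch. XV Thm. 4.4.1 (proof)] [cite: MoeglinWaldspurger1995, IV.2.1] -/
theorem integrableOn_and_setIntegral_ideleNorm_cpow_neg_of_lt (ν : Measure (GaloisRepresentations.ideleGroup K))
    [ν.IsMulLeftInvariant] [IsFiniteMeasureOnCompacts ν] [ν.IsOpenPosMeasure]
    {𝓕 : Set (GaloisRepresentations.ideleGroup K)}
    (h𝓕 : IsFundamentalDomain (GaloisRepresentations.principalIdeles K) 𝓕 ν) {s : ℂ} (hs : 0 < s.re) {T₀ : ℝ} (hT : 0 < T₀) :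
    IntegrableOn (fun x => ((IdeleClassGroup.ideleNorm K x : ℝ) : ℂ) ^ (-s))
        ({x | T₀ < (IdeleClassGroup.ideleNorm K x : ℝ)} ∩ 𝓕) ν ∧
      ∫ x in {x | T₀ < (IdeleClassGroup.ideleNorm K x : ℝ)} ∩ 𝓕,
          ((IdeleClassGroup.ideleNorm K x : ℝ) : ℂ) ^ (-s) ∂ν = (idelicCovolume K ν).toReal * (((T₀ : ℝ) : ℂ) ^ (-s) / s) := by
  have hs' : (-s).re < 0 := by simpa using hs
  have hfun : (fun x : GaloisRepresentations.ideleGroup K => ((IdeleClassGroup.ideleNorm K x : ℝ) : ℂ) ^ (-s)) =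
      fun x => (fun u : ℝ => Complex.exp (-s * u)) (logNorm K x) := by
    funext x; exact ideleNorm_cpow_eq_exp x (-s)
  have hcont : Continuous fun u : ℝ => Complex.exp (-s * u) :=
    Complex.continuous_exp.comp (continuous_const.mul Complex.continuous_ofReal)
  rw [setOf_lt_ideleNorm_eq hT, hfun]
  refine ⟨?_, ?_⟩
  · rw [integrableOn_comp_logNorm_iff ν h𝓕 measurableSet_Ioi hcont.aestronglyMeasurable]
    exact integrableOn_exp_mul_complex_Ioi hs' _
  · rw [setIntegral_comp_logNorm_eq ν h𝓕 measurableSet_Ioi hcont.aestronglyMeasurable, integral_exp_mul_complex_Ioi hs',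
      Complex.real_smul, ofReal_cpow_eq_exp hT, neg_div, ← div_neg, neg_neg]

end Tate

/-! ## §2 The weighted norm profile `(ψν)|_𝓕 ∘ (log ‖·‖)⁻¹ = c_ψ · du` for an `ℝ≥0∞`-valued density -/

section Weighted

variable [MeasurableSpace (GaloisRepresentations.ideleGroup K)] [BorelSpace (GaloisRepresentations.ideleGroup K)]

/-- A left-invariant measure with a `g`-invariant density is `g`-invariant: `(g·)_* (ψν) = ψν` when `ψ(g x) = ψ(x)`. [folklore] -/
theorem map_mul_left_withDensity_eq (ν : Measure (GaloisRepresentations.ideleGroup K)) [ν.IsMulLeftInvariant]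
    {ψ : GaloisRepresentations.ideleGroup K → ℝ≥0∞} {g : GaloisRepresentations.ideleGroup K} (hg : ∀ x, ψ (g * x) = ψ x) :
    (ν.withDensity ψ).map (fun x => g * x) = ν.withDensity ψ := by
  haveI : MeasurableMul (GaloisRepresentations.ideleGroup K) := by
    haveI := secondCountableTopology_ideleGroup K
    infer_instance
  ext S hS
  rw [Measure.map_apply (measurable_const_mul g) hS, withDensity_apply _ (measurable_const_mul g hS), withDensity_apply _ hS,
    ← lintegral_indicator (measurable_const_mul g hS), ← lintegral_indicator hS]
  have hcomp : (ψ ∘ fun x => g * x) = ψ := funext hg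
  calc ∫⁻ x, ((fun x => g * x) ⁻¹' S).indicator ψ x ∂ν = ∫⁻ x, S.indicator ψ (g * x) ∂ν := by
        refine lintegral_congr fun x => ?_
        have h := Set.indicator_comp_right (s := S) (fun x => g * x) (g := ψ) (x := x)
        rwa [hcomp] at h
    _ = ∫⁻ x, S.indicator ψ x ∂ν := lintegral_mul_left_eq_self _ g

/-- … hence `(ψν)(g • A) = (ψν)(A)` for EVERY set `A` (translate by the measurable equivalence `x ↦ g⁻¹ x`). [folklore] -/
theorem withDensity_smul_set_eq (ν : Measure (GaloisRepresentations.ideleGroup K)) [ν.IsMulLeftInvariant]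
    {ψ : GaloisRepresentations.ideleGroup K → ℝ≥0∞} {g : GaloisRepresentations.ideleGroup K} (hg : ∀ x, ψ (g * x) = ψ x)
    (A : Set (GaloisRepresentations.ideleGroup K)) :
    ν.withDensity ψ (g • A) = ν.withDensity ψ A := by
  haveI : MeasurableMul (GaloisRepresentations.ideleGroup K) := by
    haveI := secondCountableTopology_ideleGroup K
    infer_instance
  have hginv : ∀ x, ψ (g⁻¹ * x) = ψ x := fun x => by rw [← hg (g⁻¹ * x), mul_inv_cancel_left]
  have h := map_mul_left_withDensity_eq ν hginv
  have hpre : (MeasurableEquiv.mulLeft g⁻¹) ⁻¹' A = g • A := by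
    ext x
    rw [Set.mem_preimage, MeasurableEquiv.coe_mulLeft, Set.mem_smul_set_iff_inv_smul_mem, smul_eq_mul]
  calc ν.withDensity ψ (g • A) = ((ν.withDensity ψ).map (MeasurableEquiv.mulLeft g⁻¹)) A := by
        rw [MeasurableEquiv.map_apply, hpre]
    _ = ν.withDensity ψ A := by rw [MeasurableEquiv.coe_mulLeft, h]

/-- `ψν` is `K^×`-invariant for a `K^×`-invariant density `ψ`. [folklore] -/
theorem smulInvariantMeasure_withDensity (ν : Measure (GaloisRepresentations.ideleGroup K)) [ν.IsMulLeftInvariant]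
    {ψ : GaloisRepresentations.ideleGroup K → ℝ≥0∞}
    (hψK : ∀ k ∈ GaloisRepresentations.principalIdeles K, ∀ x, ψ (k * x) = ψ x) :
    SMulInvariantMeasure (GaloisRepresentations.principalIdeles K) (GaloisRepresentations.ideleGroup K) (ν.withDensity ψ) := by
  refine ⟨fun k S _ => ?_⟩
  rw [preimage_smul]
  exact withDensity_smul_set_eq ν (g := ((k⁻¹ : GaloisRepresentations.principalIdeles K) : GaloisRepresentations.ideleGroup K))
    (fun x => hψK _ (k⁻¹).2 x) S

omit [BorelSpace (GaloisRepresentations.ideleGroup K)] in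
/-- A density bounded by `C` gives a measure bounded by `C · ν`. [folklore] -/
theorem withDensity_apply_le_mul (ν : Measure (GaloisRepresentations.ideleGroup K))
    {ψ : GaloisRepresentations.ideleGroup K → ℝ≥0∞} {C : ℝ≥0∞} (hψC : ∀ x, ψ x ≤ C) (A : Set (GaloisRepresentations.ideleGroup K)) :
    ν.withDensity ψ A ≤ C * ν A := by
  have h : ν.withDensity ψ ≤ ν.withDensity (fun _ => C) := withDensity_mono (Eventually.of_forall hψC)
  rw [withDensity_const] at h
  exact (Measure.le_iff'.1 h A).trans_eq (by rw [Measure.smul_apply, smul_eq_mul])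

/-- **Translation invariance of the weighted norm profile.**  For a `K^×`- and `M`-invariant density `ψ`, `B ↦ (ψν)({log ‖x‖ ∈ B} ∩ 𝓕)` is translation invariant on `ℝ`:
translate by `t = log ‖z(r)‖` (`{log ‖x‖ ∈ t + B} = z(r)·{log ‖x‖ ∈ B}`), use the `z(r)`-invariance of `ψν` and the independence of the fundamental domain for the `K^×`-invariant
measure `ψν` (`z(r)𝓕` is again one) — the weighted twin of ★ `isAddLeftInvariant_normProfile`. [folklore] -/
theorem isAddLeftInvariant_normProfile_withDensity (ν : Measure (GaloisRepresentations.ideleGroup K)) [ν.IsMulLeftInvariant]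
    {𝓕 : Set (GaloisRepresentations.ideleGroup K)}
    (h𝓕 : IsFundamentalDomain (GaloisRepresentations.principalIdeles K) 𝓕 ν)
    {ψ : GaloisRepresentations.ideleGroup K → ℝ≥0∞}
    (hψK : ∀ k ∈ GaloisRepresentations.principalIdeles K, ∀ x, ψ (k * x) = ψ x)
    (hψM : ∀ (r : ℝ≥0ˣ) (x : GaloisRepresentations.ideleGroup K), ψ (posRealIdele K r * x) = ψ x) :
    (normProfile K (ν.withDensity ψ) 𝓕).IsAddLeftInvariant := by
  haveI : MeasurableMul (GaloisRepresentations.ideleGroup K) := by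
    haveI := secondCountableTopology_ideleGroup K
    infer_instance
  haveI : SMulCommClass (GaloisRepresentations.ideleGroup K) (GaloisRepresentations.principalIdeles K)
      (GaloisRepresentations.ideleGroup K) :=
    ⟨fun g k x => by simp only [Subgroup.smul_def, smul_eq_mul, mul_left_comm]⟩
  haveI := smulInvariantMeasure_withDensity ν hψK
  have hac : ν.withDensity ψ ≪ ν := withDensity_absolutelyContinuous ν ψ
  have h𝓕ψ : IsFundamentalDomain (GaloisRepresentations.principalIdeles K) 𝓕 (ν.withDensity ψ) := h𝓕.mono hac
  refine ⟨fun t => ?_⟩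
  obtain ⟨r, hr⟩ := exists_logNorm_posRealIdele_eq K t
  set g : GaloisRepresentations.ideleGroup K := posRealIdele K r with hg
  have hginv : ∀ x, ψ (g⁻¹ * x) = ψ x := fun x => by
    rw [hg, ← map_inv]; exact hψM r⁻¹ x
  ext B hB
  rw [Measure.map_apply (measurable_const_add t) hB, normProfile_apply _ 𝓕 hB, normProfile_apply _ 𝓕 (measurable_const_add t hB)]
  -- `{log ‖x‖ ∈ (t + ·)⁻¹ B} = g⁻¹ • {log ‖x‖ ∈ B}`
  have hset : logNorm K ⁻¹' ((fun u => t + u) ⁻¹' B) = g⁻¹ • (logNorm K ⁻¹' B) := by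
    ext x
    rw [Set.mem_smul_set_iff_inv_smul_mem, inv_inv, smul_eq_mul, Set.mem_preimage, Set.mem_preimage, Set.mem_preimage, logNorm_mul, hr]
  rw [hset]
  have hfd : IsFundamentalDomain (GaloisRepresentations.principalIdeles K) (g • 𝓕) (ν.withDensity ψ) := (h𝓕.smul_of_comm g).mono hac
  calc ν.withDensity ψ (g⁻¹ • (logNorm K ⁻¹' B) ∩ 𝓕) = ν.withDensity ψ (g⁻¹ • (logNorm K ⁻¹' B ∩ g • 𝓕)) := by
        rw [Set.smul_set_inter, inv_smul_smul]
    _ = ν.withDensity ψ (logNorm K ⁻¹' B ∩ g • 𝓕) := withDensity_smul_set_eq ν hginv _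
    _ = ν.withDensity ψ (logNorm K ⁻¹' B ∩ 𝓕) :=
        hfd.measure_set_eq h𝓕ψ (measurableSet_logNorm_preimage hB) fun k => smul_logNorm_preimage k B

/-- The weighted norm profile of a bounded density is finite on compact sets (`(ψν) ≤ C ν` and ★ `measure_logNorm_preimage_Icc_inter_lt_top`). [folklore] -/
theorem isFiniteMeasureOnCompacts_normProfile_withDensity (ν : Measure (GaloisRepresentations.ideleGroup K)) [ν.IsMulLeftInvariant]
    [IsFiniteMeasureOnCompacts ν] {𝓕 : Set (GaloisRepresentations.ideleGroup K)}
    (h𝓕 : IsFundamentalDomain (GaloisRepresentations.principalIdeles K) 𝓕 ν)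
    {ψ : GaloisRepresentations.ideleGroup K → ℝ≥0∞} {C : ℝ≥0} (hψC : ∀ x, ψ x ≤ C) :
    IsFiniteMeasureOnCompacts (normProfile K (ν.withDensity ψ) 𝓕) := by
  refine ⟨fun S hS => ?_⟩
  have hSb : S ⊆ Icc (sInf S) (sSup S) := hS.isBounded.subset_Icc_sInf_sSup
  calc normProfile K (ν.withDensity ψ) 𝓕 S ≤ normProfile K (ν.withDensity ψ) 𝓕 (Icc (sInf S) (sSup S)) := measure_mono hSb
    _ = ν.withDensity ψ (logNorm K ⁻¹' Icc (sInf S) (sSup S) ∩ 𝓕) := normProfile_apply _ 𝓕 measurableSet_Icc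
    _ ≤ C * ν (logNorm K ⁻¹' Icc (sInf S) (sSup S) ∩ 𝓕) := withDensity_apply_le_mul ν (C := (C : ℝ≥0∞)) (fun x => hψC x) _
    _ < ⊤ := ENNReal.mul_lt_top ENNReal.coe_lt_top (measure_logNorm_preimage_Icc_inter_lt_top ν h𝓕 _ _)

/-- **The weighted norm profile is a multiple of Lebesgue measure**: `(ψν)|_𝓕 ∘ (log ‖·‖)⁻¹ = c_ψ · du` with **`c_ψ = (ψν)({0 ≤ log ‖x‖ < 1} ∩ 𝓕)`** (uniqueness of Haar
measure on `ℝ`) — the weighted twin of ★ `normProfile_eq_smul_volume` (Tate's `d𝔞 = d𝔟 · dt∕t` with the `K^×·M`-invariant weight `ψ` riding on `d𝔟`).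
[cite: CasselsFrohlichANT1967, Ch. XV Thm. 4.3.2] -/
theorem normProfile_withDensity_eq_smul_volume (ν : Measure (GaloisRepresentations.ideleGroup K)) [ν.IsMulLeftInvariant]
    [IsFiniteMeasureOnCompacts ν] {𝓕 : Set (GaloisRepresentations.ideleGroup K)}
    (h𝓕 : IsFundamentalDomain (GaloisRepresentations.principalIdeles K) 𝓕 ν)
    {ψ : GaloisRepresentations.ideleGroup K → ℝ≥0∞} {C : ℝ≥0} (hψC : ∀ x, ψ x ≤ C)
    (hψK : ∀ k ∈ GaloisRepresentations.principalIdeles K, ∀ x, ψ (k * x) = ψ x)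
    (hψM : ∀ (r : ℝ≥0ˣ) (x : GaloisRepresentations.ideleGroup K), ψ (posRealIdele K r * x) = ψ x) :
    normProfile K (ν.withDensity ψ) 𝓕 = ν.withDensity ψ (logNorm K ⁻¹' Ico 0 1 ∩ 𝓕) • (volume : Measure ℝ) := by
  haveI := isAddLeftInvariant_normProfile_withDensity ν h𝓕 hψK hψM
  haveI := isFiniteMeasureOnCompacts_normProfile_withDensity ν h𝓕 hψC
  have h := Measure.isAddLeftInvariant_eq_smul (normProfile K (ν.withDensity ψ) 𝓕) (volume : Measure ℝ)
  have hc : (Measure.addHaarScalarFactor (normProfile K (ν.withDensity ψ) 𝓕) (volume : Measure ℝ) : ℝ≥0∞) =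
      ν.withDensity ψ (logNorm K ⁻¹' Ico 0 1 ∩ 𝓕) := by
    have h1 : normProfile K (ν.withDensity ψ) 𝓕 (Ico 0 1) =
        (Measure.addHaarScalarFactor (normProfile K (ν.withDensity ψ) 𝓕) (volume : Measure ℝ) • (volume : Measure ℝ)) (Ico 0 1) := by
      rw [← h]
    rw [Measure.coe_nnreal_smul_apply, Real.volume_Ico, sub_zero, ENNReal.ofReal_one, mul_one, normProfile_apply _ 𝓕 measurableSet_Ico] at h1
    exact h1.symm
  rw [h]
  ext B hB
  rw [Measure.coe_nnreal_smul_apply, Measure.smul_apply, smul_eq_mul, hc]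

/-- The restricted form: `(log ‖·‖)_* ((ψν)|_{{log ‖x‖ ∈ B} ∩ 𝓕}) = c_ψ · du|_B`. [folklore] -/
theorem map_logNorm_restrict_withDensity_eq (ν : Measure (GaloisRepresentations.ideleGroup K)) [ν.IsMulLeftInvariant]
    [IsFiniteMeasureOnCompacts ν] {𝓕 : Set (GaloisRepresentations.ideleGroup K)}
    (h𝓕 : IsFundamentalDomain (GaloisRepresentations.principalIdeles K) 𝓕 ν)
    {ψ : GaloisRepresentations.ideleGroup K → ℝ≥0∞} {C : ℝ≥0} (hψC : ∀ x, ψ x ≤ C)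
    (hψK : ∀ k ∈ GaloisRepresentations.principalIdeles K, ∀ x, ψ (k * x) = ψ x)
    (hψM : ∀ (r : ℝ≥0ˣ) (x : GaloisRepresentations.ideleGroup K), ψ (posRealIdele K r * x) = ψ x)
    {B : Set ℝ} (hB : MeasurableSet B) :
    Measure.map (logNorm K) ((ν.withDensity ψ).restrict (logNorm K ⁻¹' B ∩ 𝓕)) =
      ν.withDensity ψ (logNorm K ⁻¹' Ico 0 1 ∩ 𝓕) • (volume.restrict B : Measure ℝ) := by
  rw [← Measure.restrict_restrict (measurableSet_logNorm_preimage hB),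
    ← Measure.restrict_map (continuous_logNorm K).measurable hB,
    show Measure.map (logNorm K) ((ν.withDensity ψ).restrict 𝓕) = normProfile K (ν.withDensity ψ) 𝓕 from rfl,
    normProfile_withDensity_eq_smul_volume ν h𝓕 hψC hψK hψM, Measure.restrict_smul]

/-- **Weighted integration along the norm, `ℝ≥0∞` version**: `∫⁻_{{log ‖x‖ ∈ B} ∩ 𝓕} f(log ‖x‖) ψ(x) dν = c_ψ · ∫⁻_B f`. [folklore] -/
theorem setLIntegral_comp_logNorm_mul_eq (ν : Measure (GaloisRepresentations.ideleGroup K)) [ν.IsMulLeftInvariant]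
    [IsFiniteMeasureOnCompacts ν] {𝓕 : Set (GaloisRepresentations.ideleGroup K)} (h𝓕 : IsIdeleClassDomain K 𝓕)
    {ψ : GaloisRepresentations.ideleGroup K → ℝ≥0∞} (hψ : Measurable ψ) {C : ℝ≥0} (hψC : ∀ x, ψ x ≤ C)
    (hψK : ∀ k ∈ GaloisRepresentations.principalIdeles K, ∀ x, ψ (k * x) = ψ x)
    (hψM : ∀ (r : ℝ≥0ˣ) (x : GaloisRepresentations.ideleGroup K), ψ (posRealIdele K r * x) = ψ x)
    {B : Set ℝ} (hB : MeasurableSet B) {f : ℝ → ℝ≥0∞} (hf : Measurable f) :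
    ∫⁻ x in logNorm K ⁻¹' B ∩ 𝓕, f (logNorm K x) * ψ x ∂ν = ν.withDensity ψ (logNorm K ⁻¹' Ico 0 1 ∩ 𝓕) * ∫⁻ u in B, f u := by
  have hA : MeasurableSet (logNorm K ⁻¹' B ∩ 𝓕) := (measurableSet_logNorm_preimage hB).inter h𝓕.measurableSet
  calc ∫⁻ x in logNorm K ⁻¹' B ∩ 𝓕, f (logNorm K x) * ψ x ∂ν = ∫⁻ x in logNorm K ⁻¹' B ∩ 𝓕, (ψ * (f ∘ logNorm K)) x ∂ν :=
        lintegral_congr fun x => by rw [Pi.mul_apply, Function.comp_apply, mul_comm]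
    _ = ∫⁻ x in logNorm K ⁻¹' B ∩ 𝓕, (f ∘ logNorm K) x ∂(ν.withDensity ψ) :=
        (setLIntegral_withDensity_eq_setLIntegral_mul ν hψ (hf.comp (continuous_logNorm K).measurable) hA).symm
    _ = ∫⁻ u, f u ∂(Measure.map (logNorm K) ((ν.withDensity ψ).restrict (logNorm K ⁻¹' B ∩ 𝓕))) :=
        (lintegral_map hf (continuous_logNorm K).measurable).symm
    _ = ν.withDensity ψ (logNorm K ⁻¹' Ico 0 1 ∩ 𝓕) * ∫⁻ u in B, f u := by
        rw [map_logNorm_restrict_withDensity_eq ν (h𝓕.isFundamentalDomain ν) hψC hψK hψM hB, lintegral_smul_measure, smul_eq_mul]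

end Weighted

/-! ## §3 The unit shell has mass `V`; a non-trivial character of the compact part has mean zero -/

section Shell

variable [MeasurableSpace (GaloisRepresentations.ideleGroup K)] [BorelSpace (GaloisRepresentations.ideleGroup K)]

/-- The shell form of `[1] = V`: `ν({0 ≤ log ‖x‖ < 1} ∩ 𝓕) = idelicCovolume K ν` for every fundamental domain (★ `normProfile_Ico_eq_idelicCovolume`). [folklore] -/
theorem shell_one (ν : Measure (GaloisRepresentations.ideleGroup K)) [ν.IsMulLeftInvariant]
    {𝓕 : Set (GaloisRepresentations.ideleGroup K)} (h𝓕 : IsFundamentalDomain (GaloisRepresentations.principalIdeles K) 𝓕 ν) :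
    ν (logNorm K ⁻¹' Ico 0 1 ∩ 𝓕) = idelicCovolume K ν := by
  rw [← normProfile_apply ν 𝓕 measurableSet_Ico, normProfile_Ico_eq_idelicCovolume ν h𝓕]

/-- **`[η] = 0` FOR A NON-TRIVIAL CHARACTER OF THE COMPACT PART** (shell form): for a multiplicative `η : 𝕀_K →* ℂ` trivial on `K^×` and on `M`, and some `x₀` with `η x₀ ≠ 1`,
`∫_{𝓕 ∩ {0 ≤ log ‖x‖ < 1}} η dν = 0`.  PROOF: `b = x₀ · z(r)⁻¹` with `log ‖z(r)‖ = log ‖x₀‖` has `log ‖b‖ = 0` and `η(b) = η(x₀) ≠ 1`; translating by `b` preserves `ν` and the shell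
and moves `𝓕` to the fundamental domain `b𝓕`, over which a `K^×`-invariant function has the same integral; so `I = η(b) I`. [cite: WeilBNT1967, Ch. VII §5] -/
theorem shellIntegral_character_eq_zero (ν : Measure (GaloisRepresentations.ideleGroup K)) [ν.IsMulLeftInvariant]
    {𝓕 : Set (GaloisRepresentations.ideleGroup K)} (h𝓕 : IsIdeleClassDomain K 𝓕)
    (η : GaloisRepresentations.ideleGroup K →* ℂ)
    (hηK : ∀ k ∈ GaloisRepresentations.principalIdeles K, η k = 1) (hηM : ∀ r : ℝ≥0ˣ, η (posRealIdele K r) = 1)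
    {x₀ : GaloisRepresentations.ideleGroup K} (hx₀ : η x₀ ≠ 1) :
    ∫ x in logNorm K ⁻¹' Ico 0 1 ∩ 𝓕, η x ∂ν = 0 := by
  haveI : MeasurableMul (GaloisRepresentations.ideleGroup K) := by
    haveI := secondCountableTopology_ideleGroup K
    infer_instance
  haveI : SMulCommClass (GaloisRepresentations.ideleGroup K) (GaloisRepresentations.principalIdeles K)
      (GaloisRepresentations.ideleGroup K) :=
    ⟨fun g k x => by simp only [Subgroup.smul_def, smul_eq_mul, mul_left_comm]⟩
  -- the norm-one translate `b`
  obtain ⟨r, hr⟩ := exists_logNorm_posRealIdele_eq K (logNorm K x₀)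
  set b : GaloisRepresentations.ideleGroup K := x₀ * (posRealIdele K r)⁻¹ with hb
  have hzinv : η (posRealIdele K r)⁻¹ = 1 := by
    have h := η.map_mul (posRealIdele K r)⁻¹ (posRealIdele K r)
    rw [inv_mul_cancel, map_one, hηM r, mul_one] at h
    exact h.symm
  have hηb : η b = η x₀ := by rw [hb, map_mul, hzinv, mul_one]
  have hb0 : logNorm K b = 0 := by rw [hb, logNorm_mul, logNorm_inv, hr, add_neg_cancel]
  -- the shell indicator of `η` is `K^×`-invariant, and translation by `b` multiplies it by `η b`
  set S : Set (GaloisRepresentations.ideleGroup K) := logNorm K ⁻¹' Ico 0 1 with hS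
  have hSm : MeasurableSet S := measurableSet_logNorm_preimage measurableSet_Ico
  have hinv : ∀ (k : GaloisRepresentations.principalIdeles K) (x : GaloisRepresentations.ideleGroup K), S.indicator η (k • x) = S.indicator η x := by
    intro k x
    have hmem : k • x ∈ S ↔ x ∈ S := by
      rw [hS, Set.mem_preimage, Set.mem_preimage, Subgroup.smul_def, smul_eq_mul, logNorm_principal_mul k.2]
    by_cases hx : x ∈ S
    · rw [indicator_of_mem (hmem.2 hx), indicator_of_mem hx, Subgroup.smul_def, smul_eq_mul, map_mul, hηK _ k.2, one_mul]
    · rw [indicator_of_notMem (fun h => hx (hmem.1 h)), indicator_of_notMem hx]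
  have hfd : IsFundamentalDomain (GaloisRepresentations.principalIdeles K) (b • 𝓕) ν := (h𝓕.smul b).isFundamentalDomain ν
  have hb𝓕m : MeasurableSet (b • 𝓕) := (h𝓕.smul b).measurableSet
  -- pointwise: `𝟙_{S ∩ b𝓕} η (b x) = η b · 𝟙_{S ∩ 𝓕} η (x)`
  have hpt : ∀ x, (S ∩ b • 𝓕).indicator η (b * x) = η b * (S ∩ 𝓕).indicator η x := by
    intro x
    have hmem : b * x ∈ S ∩ b • 𝓕 ↔ x ∈ S ∩ 𝓕 := by
      rw [Set.mem_inter_iff, Set.mem_inter_iff, hS, Set.mem_preimage, Set.mem_preimage, logNorm_mul, hb0, zero_add, ← smul_eq_mul b x,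
        Set.smul_mem_smul_set_iff]
    by_cases hx : x ∈ S ∩ 𝓕
    · rw [indicator_of_mem (hmem.2 hx), indicator_of_mem hx, map_mul]
    · rw [indicator_of_notMem (fun h => hx (hmem.1 h)), indicator_of_notMem hx, mul_zero]
  -- `I = ∫_𝓕 𝟙_S η = ∫_{b𝓕} 𝟙_S η = ∫ 𝟙_{S ∩ b𝓕} η (b x) dx = η b · I`
  have hI : ∫ x in S ∩ 𝓕, η x ∂ν = η b * ∫ x in S ∩ 𝓕, η x ∂ν := by
    calc ∫ x in S ∩ 𝓕, η x ∂ν = ∫ x in 𝓕, S.indicator η x ∂ν := by rw [setIntegral_indicator hSm, Set.inter_comm]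
      _ = ∫ x in b • 𝓕, S.indicator η x ∂ν := (h𝓕.isFundamentalDomain ν).setIntegral_eq hfd hinv
      _ = ∫ x in S ∩ b • 𝓕, η x ∂ν := by rw [setIntegral_indicator hSm, Set.inter_comm]
      _ = ∫ x, (S ∩ b • 𝓕).indicator η x ∂ν := (integral_indicator (hSm.inter hb𝓕m)).symm
      _ = ∫ x, (S ∩ b • 𝓕).indicator η (b * x) ∂ν := (integral_mul_left_eq_self _ b).symm
      _ = ∫ x, η b * (S ∩ 𝓕).indicator η x ∂ν := by simp_rw [hpt]
      _ = η b * ∫ x in S ∩ 𝓕, η x ∂ν := by rw [integral_const_mul, integral_indicator (hSm.inter h𝓕.measurableSet)]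
  have h1 : (1 - η b) * ∫ x in S ∩ 𝓕, η x ∂ν = 0 := by rw [sub_mul, one_mul, ← hI, sub_self]
  rcases mul_eq_zero.1 h1 with h | h
  · exact absurd (sub_eq_zero.1 h).symm (hηb ▸ hx₀)
  · exact h

end Shell

end Summit.HodgeConjecture.HodgeConjecture.Cruxes.H413.K2E1IdeleClassMellinWeighted

end
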